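import Summits.BirchSwinnertonDyer.BirchSwinnertonDyer.Theses.KatoDescentTamePotSupersingular
import Summits.BirchSwinnertonDyer.BirchSwinnertonDyer.Theorems.KatoDescentPotSupersingularMuCoreIrrConjAOdd
import Literature.NumberTheory.EllipticCurves.Kato2004.EulerSystemClassNonvanishingProofs
import Literature.NumberTheory.EllipticCurves.CuspFormLFunctionAnalyticRankProofs
import HarnessLib

/-!
# KT crux `TameCoatesSujathaResidue` (item stmt-BirchSwinnertonDyer-19916, the Conj-A residue of the (t′) U₀-ns node 19202 /
# U₀ parent 19982) BY NAME from Kato's zeta-body inputs {modularity, `exists_eulerSystem_expStar_values`} and ONE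
# pinned, scale-invariant statement about Kato's Λ-adic zeta LINE at `p` — CONDITIONAL closer-helper (item stays open)

Seat `bsd-potss-k9-c4` g15 (prover; cell `bsd-potss`; courtesy for the KT lane, twin of the K9 file
`KatoDescentPotSupersingularWildCoatesSujathaResidueOfKatoZetaLine.lean`); `--supports stmt-BirchSwinnertonDyer-19916
--as helper`; closes nothing (conditional-result).  HONEST FRAMING: BSD is not proved by any of this; Conjecture A is
NOT proved; nothing is booked.  Kernel content of plan g25's split kit for 19916 with its child 2 CORRECTED to the
scale-invariant form (the spec's naive pin is refuted by `ZetaLineScaling.not_forall_zetaBody_lift_not_mem`): third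
hypothesis = «for every admissible zeta body of `W` at `p` and every non-zero Λ-adic lift `y`, some genuine
Euler-system class `s ∉ p·𝐇¹_Γ` has `p^k • s = y`».  Proof as in the K9 twin, concluding with k9-c4 g14's
`MuCoreIrr.exists_fineSelmerDualData_moduleFinite_of_irr_of_not_towerSurj_of_eulerClass` (odd `p`; `p ≥ 5` via the K6
image facts, `p = 3` via the irreducible-only core).

References: [Kato2004Asterisque] §13.1, Thm. 13.4 (pp. 224–226), Ex. 13.3 (p. 225), Thm. 12.5 (1) (pp. 221–222),
§13.8; [CoatesSujatha2005] Conjecture A; [BreuilConradDiamondTaylor2001] Thm. A; [Serre1972] §2.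
-/

-- the summit and its single problem are both named `BirchSwinnertonDyer` (registry layout D-0017)
set_option linter.dupNamespace false
set_option autoImplicit false

noncomputable section

open Field WeierstrassCurve
open Literature.NumberTheory.GaloisRepresentations Literature.NumberTheory.EllipticCurves
open Literature.NumberTheory.EllipticCurves.ModularForms
open Literature.NumberTheory.EllipticCurves.Kato2004 Literature.NumberTheory.EllipticCurves.Kato2004.EulerSystemValues

namespace Summit.BirchSwinnertonDyer.BirchSwinnertonDyer.Theorems

/-- **`TameCoatesSujathaResidue` (item 19916) from modularity, Kato's zeta Euler system with values, and the
indivisible-generator statement for Kato's zeta line at `p`**, by name: CONDITIONAL closer-helper (the three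
hypotheses are, verbatim, `ModularForms.exists_isNewformOf`, `Kato2004.exists_eulerSystem_expStar_values` and the
g15 split-kit child `TameKatoZetaIndivisible`); the item is not closed by this theorem.
[cite: Kato2004Asterisque, §13.1 and Thm. 13.4 (pp. 224–226), Ex. 13.3 (p. 225), Thm. 12.5 (1) (pp. 221–222), §13.8 (pp. 228–229)]
[cite: CoatesSujatha2005, §3 and Conjecture A] [cite: BreuilConradDiamondTaylor2001, Thm. A] -/
theorem tameCoatesSujathaResidue_of_katoZetaLine (hmod : exists_isNewformOf) (hES : exists_eulerSystem_expStar_values)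
    (hZL : ∀ (W : WeierstrassCurve ℚ) [W.IsElliptic] [W.IsGloballyMinimal] (p : ℕ) [Fact p.Prime], W.analyticRank = 0 → p ≠ 2 → Literature.NumberTheory.EllipticCurves.Rank1Residual.Addv W p → Summit.BirchSwinnertonDyer.Rank1Residual.Additive.SubTprime W p → ¬ W.HasCM → W.HasIrreducibleModPGaloisRep p → ¬ (∀ n : ℕ, W.HasSurjectiveModNGaloisRep (p ^ n : ℕ)) → (∃ (W₀ : WeierstrassCurve ℚ) (_ : W₀.IsElliptic) (_ : W₀.IsGloballyMinimal) (_ : NeZero (W₀.conductorNorm ℤ)) (D₀ : Literature.NumberTheory.EllipticCurves.ModularForms.ModularParametrizationData W₀ (W₀.conductorNorm ℤ)), WeierstrassCurve.IsIsogenous W W₀ ∧ (∀ z ∈ D₀.L.lattice, ∃ w ∈ Literature.NumberTheory.EllipticCurves.ModularForms.periodLattice D₀.f, z = (D₀.c : ℂ) * w) ∧ ((p : ℤ) ∣ D₀.c ∨ (p ∣ W₀.tamagawaProduct ∧ ¬ ∃ (q : ℕ) (_ : Fact q.Prime), q ∣ W₀.conductorNorm ℤ ∧ ¬ q ^ 2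 ∣ W₀.conductorNorm ℤ ∧ q ≠ p ∧ padicValNat p W₀.tamagawaProduct ≤ padicValNat p ((W₀.baseChange ℚ_[q]).localTamagawaNumber ℤ_[q])))) → ∀ (hp : p ≠ 2) (κ : Literature.NumberTheory.EllipticCurves.ZpExtension ℚ p) (hκ : κ.IsCyclotomic) [ContinuousSMul ℤ_[p] (W.tateModule p)] [Module.Free ℤ_[p] (W.tateModule p)] [Module.Finite ℤ_[p] (W.tateModule p)] (γ : Field.absoluteGaloisGroup ℚ) (I : Literature.NumberTheory.EllipticCurves.Kato2004.IwasawaH1Data W p κ γ), κ.IsTopGenerator γ → ∀ {N : ℕ} [NeZero N] (f : CuspForm (CongruenceSubgroup.Gamma0 N) 2), Literature.NumberTheory.EllipticCurves.ModularForms.IsNewformOf W f → ∀ (ι : (m : ℕ) → (CyclotomicField m ℚ →+* ℂ)) (κ' : ℝ) (Λ' : ∀ (k : ℕ) (r : Finset (IsDedekindDomain.HeightOneSpectrum (NumberField.RingOfIntegers ℚ))), Literature.NumberTheory.GaloisRepresentations.H1 (Literature.NumberTheory.EllipticCurves.Kato2004.EulerSystemValues.tateRep W p) (Literature.NumberTheory.EllipticCurves.Kato2004.EulerSystemValues.cycSubgroup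 p k r) →ₗ[ℤ_[p]] TensorProduct ℚ ℚ_[p] (CyclotomicField (Literature.NumberTheory.EllipticCurves.Kato2004.EulerSystemValues.cycLevel p k r) ℚ)) (c d a : ℤ) (A : ℕ), 0 < A → Int.gcd c (6 * p * A) = 1 → Int.gcd d (6 * p * N) = 1 → ∀ (z : ∀ (k : ℕ) (r : (Literature.NumberTheory.GaloisRepresentations.cyclotomicLevelsRat p (Literature.NumberTheory.EllipticCurves.Kato2004.EulerSystemValues.badPlaces c d A N)).Ideals), Literature.NumberTheory.GaloisRepresentations.H1 (Literature.NumberTheory.EllipticCurves.Kato2004.EulerSystemValues.tateRep W p) ((Literature.NumberTheory.GaloisRepresentations.cyclotomicLevelsRat p (Literature.NumberTheory.EllipticCurves.Kato2004.EulerSystemValues.badPlaces c d A N)).level k r.1)) (x : ∀ (k : ℕ) (r : (Literature.NumberTheory.GaloisRepresentations.cyclotomicLevelsRat p (Literature.NumberTheory.EllipticCurves.Kato2004.EulerSystemValues.badPlaces c d A N)).Ideals), CyclotomicField (Literature.NumberTheory.EllipticCurves.Kato2004.EulerSystemValues.cycLevel p k r.1) ℚ), Literature.NumberTheory.EllipticCurves.Kato2004.ZetaBody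 W p f ι κ' Λ' c d a A z x → ∀ (y : I.H), (∀ n : ℕ, I.proj n y = Literature.NumberTheory.EllipticCurves.Kato2004.levelToLayer W p hκ hp (Literature.NumberTheory.EllipticCurves.Kato2004.EulerSystemValues.badPlaces c d A N) n (z (n + 1) (Literature.NumberTheory.GaloisRepresentations.cyclotomicLevelsRat p (Literature.NumberTheory.EllipticCurves.Kato2004.EulerSystemValues.badPlaces c d A N)).idealOne)) → y ≠ 0 → ∃ (s : I.H) (k : ℕ), Literature.NumberTheory.EllipticCurves.Kato2004.IsEulerSystemClass W p κ γ I s ∧ s ∉ Literature.NumberTheory.EllipticCurves.IwasawaAlgebra.augIdealP p • (⊤ : Submodule (Literature.NumberTheory.EllipticCurves.IwasawaAlgebra p) I.H) ∧ (p ^ k : ℕ) • s = y) :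
    Summit.BirchSwinnertonDyer.BirchSwinnertonDyer.Theses.KatoDescentTamePotSupersingular.TameCoatesSujathaResidue := by
  intro W _ _ p _ hr hp2 hadd hsub hCM hirr hnt hopt κ hκ
  refine MuCoreIrr.exists_fineSelmerDualData_moduleFinite_of_irr_of_not_towerSurj_of_eulerClass W p hp2 hirr hnt κ hκ ?_
  intro γ I hγ
  letI : ContinuousSMul ℤ_[p] (W.tateModule p) := TateModule.continuousSMul_padicInt
  haveI : Module.Free ℤ_[p] (W.tateModule p) := W.module_free_tateModule_holds p
  haveI : Module.Finite ℤ_[p] (W.tateModule p) := W.module_finite_tateModule_holds p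
  haveI : NeZero (W.conductorNorm ℤ) := ⟨W.conductorNorm_pos_holds.ne'⟩
  -- modularity: the newform of `W`
  obtain ⟨f, hf⟩ := hmod W
  -- Kato's zeta Euler system with values for an admissible guarded datum
  set ι : (m : ℕ) → (CyclotomicField m ℚ →+* ℂ) :=
    fun m ↦ Classical.choice (inferInstance : Nonempty (CyclotomicField m ℚ →+* ℂ)) with hι
  obtain ⟨κ', hκ'0, Λ', hfam⟩ := hES W p hirr f hf ι
  obtain ⟨c, d, a, A, d', hA, hc, hd, hcd, hdd', hR⟩ := valueGuard_satisfiable f hf.1 hf.coeffField_eq_bot p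
  obtain ⟨z, x, hbody⟩ := hfam c d a A hA hc hd
  have hne := two_mul_natAbs_ne_zero_of_guards p hA (NeZero.ne (W.conductorNorm ℤ)) hc hd
  -- the unique Λ-adic lift, a genuine Euler-system class
  obtain ⟨y, _hyES, hy⟩ := exists_isEulerSystemClass_of_zetaBody W p hκ hp2 I f ι κ' Λ' c d a A z x hbody hne
  -- `L(W,1) ≠ 0` from `r_an = 0` (the entire continuation exists by modularity)
  have hL1 : W.entireLFunction 1 ≠ 0 := (W.analyticRank_eq_zero_iff_holds hf.hasEntireLFunction).mp hr
  have hy0 : y ≠ 0 := lift_ne_zero_of_bottom_ne_zero W p hκ I hp2 (badPlaces c d A (W.conductorNorm ℤ)) hbody.1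
    (zetaBody_bottom_ne_zero hbody hf hκ'0 hL1 hA d' hcd hdd' hR) hy
  -- the `p`-indivisible generator of the saturated zeta line is a genuine Euler-system class
  obtain ⟨s, _k, hsES, hs, _hsy⟩ := hZL W p hr hp2 hadd hsub hCM hirr hnt hopt hp2 κ hκ γ I hγ f hf ι κ' Λ' c d a A hA hc
    hd z x hbody y hy hy0
  exact ⟨s, hsES, hs⟩

/-- **Glue-shaped form** (the closer of the planner's split glue `TameCoatesSujathaResidueOfKatoZeta :
HeldKatoZetaBodyInputs → TameKatoZetaIndivisible → TameCoatesSujathaResidue`, first child = the conjunction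
`exists_isNewformOf ∧ exists_eulerSystem_expStar_values`).  Conditional; nothing else assumed.
[cite: Kato2004Asterisque, Ex. 13.3 (p. 225), Thm. 12.5 (1) (pp. 221–222)] [cite: CoatesSujatha2005, Conjecture A] -/
theorem tameCoatesSujathaResidue_of_katoZetaBodyInputs_of_katoZetaLine
    (hIn : (exists_isNewformOf : Prop) ∧ (exists_eulerSystem_expStar_values : Prop))
    (hZL : ∀ (W : WeierstrassCurve ℚ) [W.IsElliptic] [W.IsGloballyMinimal] (p : ℕ) [Fact p.Prime], W.analyticRank = 0 → p ≠ 2 → Literature.NumberTheory.EllipticCurves.Rank1Residual.Addv W p → Summit.BirchSwinnertonDyer.Rank1Residual.Additive.SubTprime W p → ¬ W.HasCM → W.HasIrreducibleModPGaloisRep p → ¬ (∀ n : ℕ, W.HasSurjectiveModNGaloisRep (p ^ n : ℕ)) → (∃ (W₀ : WeierstrassCurve ℚ) (_ : W₀.IsElliptic) (_ : W₀.IsGloballyMinimal) (_ : NeZero (W₀.conductorNorm ℤ)) (D₀ : Literature.NumberTheory.EllipticCurves.ModularForms.ModularParametrizationData W₀ (W₀.conductorNorm ℤ)), WeierstrassCurve.IsIsogenous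 W W₀ ∧ (∀ z ∈ D₀.L.lattice, ∃ w ∈ Literature.NumberTheory.EllipticCurves.ModularForms.periodLattice D₀.f, z = (D₀.c : ℂ) * w) ∧ ((p : ℤ) ∣ D₀.c ∨ (p ∣ W₀.tamagawaProduct ∧ ¬ ∃ (q : ℕ) (_ : Fact q.Prime), q ∣ W₀.conductorNorm ℤ ∧ ¬ q ^ 2 ∣ W₀.conductorNorm ℤ ∧ q ≠ p ∧ padicValNat p W₀.tamagawaProduct ≤ padicValNat p ((W₀.baseChange ℚ_[q]).localTamagawaNumber ℤ_[q])))) → ∀ (hp : p ≠ 2) (κ : Literature.NumberTheory.EllipticCurves.ZpExtension ℚ p) (hκ : κ.IsCyclotomic) [ContinuousSMul ℤ_[p] (W.tateModule p)] [Module.Free ℤ_[p] (W.tateModule p)] [Module.Finite ℤ_[p] (W.tateModule p)] (γ : Field.absoluteGaloisGroup ℚ) (I : Literature.NumberTheory.EllipticCurves.Kato2004.IwasawaH1Data W p κ γ), κ.IsTopGenerator γ → ∀ {N : ℕ} [NeZero N] (f : CuspForm (CongruenceSubgroup.Gamma0 N) 2), Literature.NumberTheory.EllipticCurves.ModularForms.IsNewformOf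 W f → ∀ (ι : (m : ℕ) → (CyclotomicField m ℚ →+* ℂ)) (κ' : ℝ) (Λ' : ∀ (k : ℕ) (r : Finset (IsDedekindDomain.HeightOneSpectrum (NumberField.RingOfIntegers ℚ))), Literature.NumberTheory.GaloisRepresentations.H1 (Literature.NumberTheory.EllipticCurves.Kato2004.EulerSystemValues.tateRep W p) (Literature.NumberTheory.EllipticCurves.Kato2004.EulerSystemValues.cycSubgroup p k r) →ₗ[ℤ_[p]] TensorProduct ℚ ℚ_[p] (CyclotomicField (Literature.NumberTheory.EllipticCurves.Kato2004.EulerSystemValues.cycLevel p k r) ℚ)) (c d a : ℤ) (A : ℕ), 0 < A → Int.gcd c (6 * p * A) = 1 → Int.gcd d (6 * p * N) = 1 → ∀ (z : ∀ (k : ℕ) (r : (Literature.NumberTheory.GaloisRepresentations.cyclotomicLevelsRat p (Literature.NumberTheory.EllipticCurves.Kato2004.EulerSystemValues.badPlaces c d A N)).Ideals), Literature.NumberTheory.GaloisRepresentations.H1 (Literature.NumberTheory.EllipticCurves.Kato2004.EulerSystemValues.tateRep W p) ((Literature.NumberTheory.GaloisRepresentations.cyclotomicLevelsRat p (Literature.NumberTheory.EllipticCurves.Kato2004.EulerSystemValues.badPlaces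 c d A N)).level k r.1)) (x : ∀ (k : ℕ) (r : (Literature.NumberTheory.GaloisRepresentations.cyclotomicLevelsRat p (Literature.NumberTheory.EllipticCurves.Kato2004.EulerSystemValues.badPlaces c d A N)).Ideals), CyclotomicField (Literature.NumberTheory.EllipticCurves.Kato2004.EulerSystemValues.cycLevel p k r.1) ℚ), Literature.NumberTheory.EllipticCurves.Kato2004.ZetaBody W p f ι κ' Λ' c d a A z x → ∀ (y : I.H), (∀ n : ℕ, I.proj n y = Literature.NumberTheory.EllipticCurves.Kato2004.levelToLayer W p hκ hp (Literature.NumberTheory.EllipticCurves.Kato2004.EulerSystemValues.badPlaces c d A N) n (z (n + 1) (Literature.NumberTheory.GaloisRepresentations.cyclotomicLevelsRat p (Literature.NumberTheory.EllipticCurves.Kato2004.EulerSystemValues.badPlaces c d A N)).idealOne)) → y ≠ 0 → ∃ (s : I.H) (k : ℕ), Literature.NumberTheory.EllipticCurves.Kato2004.IsEulerSystemClass W p κ γ I s ∧ s ∉ Literature.NumberTheory.EllipticCurves.IwasawaAlgebra.augIdealP p • (⊤ : Submodule (Literature.NumberTheory.EllipticCurves.IwasawaAlgebra p) I.H) ∧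 (p ^ k : ℕ) • s = y) :
    Summit.BirchSwinnertonDyer.BirchSwinnertonDyer.Theses.KatoDescentTamePotSupersingular.TameCoatesSujathaResidue :=
  tameCoatesSujathaResidue_of_katoZetaLine hIn.1 hIn.2 hZL

/-! ## Appended (k9-c4 g15): the WEAKER «Λ-multiple» form of the third hypothesis — the child the g15 kit files -/

/-- **`TameCoatesSujathaResidue` (item 19916) from modularity, Kato's zeta Euler system with values, and «every
non-zero Λ-adic lift of every admissible zeta body of `W` at `p` is a `Λ`-MULTIPLE of a genuine Euler-system class
outside `p·𝐇¹_Γ`»** (the g15 split-kit child `TameKatoZetaIndivisible` in its filed, weakest pinned form).  Same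
proof as `tameCoatesSujathaResidue_of_katoZetaLine`.  CONDITIONAL; the item is not closed by this theorem.
[cite: Kato2004Asterisque, §13.1 and Thm. 13.4 (pp. 224–226), Ex. 13.3 (p. 225), Thm. 12.5 (1) (pp. 221–222), §13.8 (pp. 228–229)]
[cite: CoatesSujatha2005, §3 and Conjecture A] [cite: BreuilConradDiamondTaylor2001, Thm. A] -/
theorem tameCoatesSujathaResidue_of_katoZetaMultiple (hmod : exists_isNewformOf)
    (hES : exists_eulerSystem_expStar_values)
    (hZM : ∀ (W : WeierstrassCurve ℚ) [W.IsElliptic] [W.IsGloballyMinimal] (p : ℕ) [Fact p.Prime], W.analyticRank = 0 → p ≠ 2 → Literature.NumberTheory.EllipticCurves.Rank1Residual.Addv W p → Summit.BirchSwinnertonDyer.Rank1Residual.Additive.SubTprime W p → ¬ W.HasCM → W.HasIrreducibleModPGaloisRep p → ¬ (∀ n : ℕ, W.HasSurjectiveModNGaloisRep (p ^ n : ℕ)) → (∃ (W₀ : WeierstrassCurve ℚ) (_ : W₀.IsElliptic) (_ : W₀.IsGloballyMinimal) (_ : NeZero (W₀.conductorNorm ℤ)) (D₀ : Literature.NumberTheory.EllipticCurves.ModularForms.ModularParametrizationData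 W₀ (W₀.conductorNorm ℤ)), WeierstrassCurve.IsIsogenous W W₀ ∧ (∀ z ∈ D₀.L.lattice, ∃ w ∈ Literature.NumberTheory.EllipticCurves.ModularForms.periodLattice D₀.f, z = (D₀.c : ℂ) * w) ∧ ((p : ℤ) ∣ D₀.c ∨ (p ∣ W₀.tamagawaProduct ∧ ¬ ∃ (q : ℕ) (_ : Fact q.Prime), q ∣ W₀.conductorNorm ℤ ∧ ¬ q ^ 2 ∣ W₀.conductorNorm ℤ ∧ q ≠ p ∧ padicValNat p W₀.tamagawaProduct ≤ padicValNat p ((W₀.baseChange ℚ_[q]).localTamagawaNumber ℤ_[q])))) → ∀ (hp : p ≠ 2) (κ : Literature.NumberTheory.EllipticCurves.ZpExtension ℚ p) (hκ : κ.IsCyclotomic) [ContinuousSMul ℤ_[p] (W.tateModule p)] [Module.Free ℤ_[p] (W.tateModule p)] [Module.Finite ℤ_[p] (W.tateModule p)] (γ : Field.absoluteGaloisGroup ℚ) (I : Literature.NumberTheory.EllipticCurves.Kato2004.IwasawaH1Data W p κ γ), κ.IsTopGenerator γ → ∀ {N : ℕ} [NeZero N] (f : CuspForm (CongruenceSubgroup.Gamma0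 N) 2), Literature.NumberTheory.EllipticCurves.ModularForms.IsNewformOf W f → ∀ (ι : (m : ℕ) → (CyclotomicField m ℚ →+* ℂ)) (κ' : ℝ) (Λ' : ∀ (k : ℕ) (r : Finset (IsDedekindDomain.HeightOneSpectrum (NumberField.RingOfIntegers ℚ))), Literature.NumberTheory.GaloisRepresentations.H1 (Literature.NumberTheory.EllipticCurves.Kato2004.EulerSystemValues.tateRep W p) (Literature.NumberTheory.EllipticCurves.Kato2004.EulerSystemValues.cycSubgroup p k r) →ₗ[ℤ_[p]] TensorProduct ℚ ℚ_[p] (CyclotomicField (Literature.NumberTheory.EllipticCurves.Kato2004.EulerSystemValues.cycLevel p k r) ℚ)) (c d a : ℤ) (A : ℕ), 0 < A → Int.gcd c (6 * p * A) = 1 → Int.gcd d (6 * p * N) = 1 → ∀ (z : ∀ (k : ℕ) (r : (Literature.NumberTheory.GaloisRepresentations.cyclotomicLevelsRat p (Literature.NumberTheory.EllipticCurves.Kato2004.EulerSystemValues.badPlaces c d A N)).Ideals), Literature.NumberTheory.GaloisRepresentations.H1 (Literature.NumberTheory.EllipticCurves.Kato2004.EulerSystemValues.tateRep W p) ((Literature.NumberTheory.GaloisRepresentations.cyclotomicLevelsRat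 p (Literature.NumberTheory.EllipticCurves.Kato2004.EulerSystemValues.badPlaces c d A N)).level k r.1)) (x : ∀ (k : ℕ) (r : (Literature.NumberTheory.GaloisRepresentations.cyclotomicLevelsRat p (Literature.NumberTheory.EllipticCurves.Kato2004.EulerSystemValues.badPlaces c d A N)).Ideals), CyclotomicField (Literature.NumberTheory.EllipticCurves.Kato2004.EulerSystemValues.cycLevel p k r.1) ℚ), Literature.NumberTheory.EllipticCurves.Kato2004.ZetaBody W p f ι κ' Λ' c d a A z x → ∀ (y : I.H), (∀ n : ℕ, I.proj n y = Literature.NumberTheory.EllipticCurves.Kato2004.levelToLayer W p hκ hp (Literature.NumberTheory.EllipticCurves.Kato2004.EulerSystemValues.badPlaces c d A N) n (z (n + 1) (Literature.NumberTheory.GaloisRepresentations.cyclotomicLevelsRat p (Literature.NumberTheory.EllipticCurves.Kato2004.EulerSystemValues.badPlaces c d A N)).idealOne)) → y ≠ 0 → ∃ (s : I.H) (a : Literature.NumberTheory.EllipticCurves.IwasawaAlgebra p), Literature.NumberTheory.EllipticCurves.Kato2004.IsEulerSystemClass W p κ γ I s ∧ s ∉ Literature.NumberTheory.EllipticCurves.IwasawaAlgebra.augIdealP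 p • (⊤ : Submodule (Literature.NumberTheory.EllipticCurves.IwasawaAlgebra p) I.H) ∧ a • s = y) :
    Summit.BirchSwinnertonDyer.BirchSwinnertonDyer.Theses.KatoDescentTamePotSupersingular.TameCoatesSujathaResidue := by
  intro W _ _ p _ hr hp2 hadd hsub hCM hirr hnt hopt κ hκ
  refine MuCoreIrr.exists_fineSelmerDualData_moduleFinite_of_irr_of_not_towerSurj_of_eulerClass W p hp2 hirr hnt κ hκ ?_
  intro γ I hγ
  letI : ContinuousSMul ℤ_[p] (W.tateModule p) := TateModule.continuousSMul_padicInt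
  haveI : Module.Free ℤ_[p] (W.tateModule p) := W.module_free_tateModule_holds p
  haveI : Module.Finite ℤ_[p] (W.tateModule p) := W.module_finite_tateModule_holds p
  haveI : NeZero (W.conductorNorm ℤ) := ⟨W.conductorNorm_pos_holds.ne'⟩
  -- modularity: the newform of `W`
  obtain ⟨f, hf⟩ := hmod W
  -- Kato's zeta Euler system with values for an admissible guarded datum
  set ι : (m : ℕ) → (CyclotomicField m ℚ →+* ℂ) :=
    fun m ↦ Classical.choice (inferInstance : Nonempty (CyclotomicField m ℚ →+* ℂ)) with hι
  obtain ⟨κ', hκ'0, Λ', hfam⟩ := hES W p hirr f hf ι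
  obtain ⟨c, d, a, A, d', hA, hc, hd, hcd, hdd', hR⟩ := valueGuard_satisfiable f hf.1 hf.coeffField_eq_bot p
  obtain ⟨z, x, hbody⟩ := hfam c d a A hA hc hd
  have hne := two_mul_natAbs_ne_zero_of_guards p hA (NeZero.ne (W.conductorNorm ℤ)) hc hd
  -- the unique Λ-adic lift, a genuine Euler-system class
  obtain ⟨y, _hyES, hy⟩ := exists_isEulerSystemClass_of_zetaBody W p hκ hp2 I f ι κ' Λ' c d a A z x hbody hne
  -- `L(W,1) ≠ 0` from `r_an = 0` (the entire continuation exists by modularity)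
  have hL1 : W.entireLFunction 1 ≠ 0 := (W.analyticRank_eq_zero_iff_holds hf.hasEntireLFunction).mp hr
  have hy0 : y ≠ 0 := lift_ne_zero_of_bottom_ne_zero W p hκ I hp2 (badPlaces c d A (W.conductorNorm ℤ)) hbody.1
    (zetaBody_bottom_ne_zero hbody hf hκ'0 hL1 hA d' hcd hdd' hR) hy
  -- the `p`-indivisible generator of the saturated zeta line is a genuine Euler-system class
  obtain ⟨s, _a, hsES, hs, _hsy⟩ := hZM W p hr hp2 hadd hsub hCM hirr hnt hopt hp2 κ hκ γ I hγ f hf ι κ' Λ' c d a A hA hc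
    hd z x hbody y hy hy0
  exact ⟨s, hsES, hs⟩

/-- **Glue-shaped form** of `tameCoatesSujathaResidue_of_katoZetaMultiple` (closer of the planner's split glue
`TameCoatesSujathaResidueOfKatoZeta` with the multiple-form child).  Conditional; nothing else assumed.
[cite: Kato2004Asterisque, Ex. 13.3 (p. 225), Thm. 12.5 (1) (pp. 221–222)] [cite: CoatesSujatha2005, Conjecture A] -/
theorem tameCoatesSujathaResidue_of_katoZetaBodyInputs_of_katoZetaMultiple
    (hIn : (exists_isNewformOf : Prop) ∧ (exists_eulerSystem_expStar_values : Prop))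
    (hZM : ∀ (W : WeierstrassCurve ℚ) [W.IsElliptic] [W.IsGloballyMinimal] (p : ℕ) [Fact p.Prime], W.analyticRank = 0 → p ≠ 2 → Literature.NumberTheory.EllipticCurves.Rank1Residual.Addv W p → Summit.BirchSwinnertonDyer.Rank1Residual.Additive.SubTprime W p → ¬ W.HasCM → W.HasIrreducibleModPGaloisRep p → ¬ (∀ n : ℕ, W.HasSurjectiveModNGaloisRep (p ^ n : ℕ)) → (∃ (W₀ : WeierstrassCurve ℚ) (_ : W₀.IsElliptic) (_ : W₀.IsGloballyMinimal) (_ : NeZero (W₀.conductorNorm ℤ)) (D₀ : Literature.NumberTheory.EllipticCurves.ModularForms.ModularParametrizationData W₀ (W₀.conductorNorm ℤ)), WeierstrassCurve.IsIsogenous W W₀ ∧ (∀ z ∈ D₀.L.lattice, ∃ w ∈ Literature.NumberTheory.EllipticCurves.ModularForms.periodLattice D₀.f, z = (D₀.c : ℂ) * w) ∧ ((p : ℤ) ∣ D₀.c ∨ (p ∣ W₀.tamagawaProduct ∧ ¬ ∃ (q : ℕ) (_ : Fact q.Prime), q ∣ W₀.conductorNorm ℤ ∧ ¬ q ^ 2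 ∣ W₀.conductorNorm ℤ ∧ q ≠ p ∧ padicValNat p W₀.tamagawaProduct ≤ padicValNat p ((W₀.baseChange ℚ_[q]).localTamagawaNumber ℤ_[q])))) → ∀ (hp : p ≠ 2) (κ : Literature.NumberTheory.EllipticCurves.ZpExtension ℚ p) (hκ : κ.IsCyclotomic) [ContinuousSMul ℤ_[p] (W.tateModule p)] [Module.Free ℤ_[p] (W.tateModule p)] [Module.Finite ℤ_[p] (W.tateModule p)] (γ : Field.absoluteGaloisGroup ℚ) (I : Literature.NumberTheory.EllipticCurves.Kato2004.IwasawaH1Data W p κ γ), κ.IsTopGenerator γ → ∀ {N : ℕ} [NeZero N] (f : CuspForm (CongruenceSubgroup.Gamma0 N) 2), Literature.NumberTheory.EllipticCurves.ModularForms.IsNewformOf W f → ∀ (ι : (m : ℕ) → (CyclotomicField m ℚ →+* ℂ)) (κ' : ℝ) (Λ' : ∀ (k : ℕ) (r : Finset (IsDedekindDomain.HeightOneSpectrum (NumberField.RingOfIntegers ℚ))), Literature.NumberTheory.GaloisRepresentations.H1 (Literature.NumberTheory.EllipticCurves.Kato2004.EulerSystemValues.tateRep W p) (Literature.NumberTheory.EllipticCurves.Kato2004.EulerSystemValues.cycSubgroup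 p k r) →ₗ[ℤ_[p]] TensorProduct ℚ ℚ_[p] (CyclotomicField (Literature.NumberTheory.EllipticCurves.Kato2004.EulerSystemValues.cycLevel p k r) ℚ)) (c d a : ℤ) (A : ℕ), 0 < A → Int.gcd c (6 * p * A) = 1 → Int.gcd d (6 * p * N) = 1 → ∀ (z : ∀ (k : ℕ) (r : (Literature.NumberTheory.GaloisRepresentations.cyclotomicLevelsRat p (Literature.NumberTheory.EllipticCurves.Kato2004.EulerSystemValues.badPlaces c d A N)).Ideals), Literature.NumberTheory.GaloisRepresentations.H1 (Literature.NumberTheory.EllipticCurves.Kato2004.EulerSystemValues.tateRep W p) ((Literature.NumberTheory.GaloisRepresentations.cyclotomicLevelsRat p (Literature.NumberTheory.EllipticCurves.Kato2004.EulerSystemValues.badPlaces c d A N)).level k r.1)) (x : ∀ (k : ℕ) (r : (Literature.NumberTheory.GaloisRepresentations.cyclotomicLevelsRat p (Literature.NumberTheory.EllipticCurves.Kato2004.EulerSystemValues.badPlaces c d A N)).Ideals), CyclotomicField (Literature.NumberTheory.EllipticCurves.Kato2004.EulerSystemValues.cycLevel p k r.1) ℚ), Literature.NumberTheory.EllipticCurves.Kato2004.ZetaBody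 W p f ι κ' Λ' c d a A z x → ∀ (y : I.H), (∀ n : ℕ, I.proj n y = Literature.NumberTheory.EllipticCurves.Kato2004.levelToLayer W p hκ hp (Literature.NumberTheory.EllipticCurves.Kato2004.EulerSystemValues.badPlaces c d A N) n (z (n + 1) (Literature.NumberTheory.GaloisRepresentations.cyclotomicLevelsRat p (Literature.NumberTheory.EllipticCurves.Kato2004.EulerSystemValues.badPlaces c d A N)).idealOne)) → y ≠ 0 → ∃ (s : I.H) (a : Literature.NumberTheory.EllipticCurves.IwasawaAlgebra p), Literature.NumberTheory.EllipticCurves.Kato2004.IsEulerSystemClass W p κ γ I s ∧ s ∉ Literature.NumberTheory.EllipticCurves.IwasawaAlgebra.augIdealP p • (⊤ : Submodule (Literature.NumberTheory.EllipticCurves.IwasawaAlgebra p) I.H) ∧ a • s = y) :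
    Summit.BirchSwinnertonDyer.BirchSwinnertonDyer.Theses.KatoDescentTamePotSupersingular.TameCoatesSujathaResidue :=
  tameCoatesSujathaResidue_of_katoZetaMultiple hIn.1 hIn.2 hZM

end Summit.BirchSwinnertonDyer.BirchSwinnertonDyer.Theorems
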